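import Mathlib
import HarnessLib

/-!
# The Kővári–Sós–Turán theorem (Zarankiewicz's problem)

S. Jukna, *Extremal Combinatorics — with applications in computer science* (1st ed., Springer 2001)
[Jukna2001], Chapter 2 "Advanced counting", §2.2 "Zarankiewicz's problem", Theorem 2.4
with the printed proof (double counting of "stars" + Jensen's inequality); original: T. Kővári,
V. T. Sós, P. Turán, *On a problem of K. Zarankiewicz*, Colloq. Math. 3 (1954) 50–57
[KovariSosTuran1954].

**Theorem 2.4 (Kővári–Sós–Turán 1954).** Let `k_a(n)` be the least `k` such that every bipartite
graph with parts of size `n` and more than `k` edges contains an `a × a` clique. Then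
`k_a(n) ≤ (a−1)^{1/a} n^{2−1/a} + (a−1) n`.

Printed proof: a *star* is `S(x,B) = {(x,y) : y ∈ B}` with `|B| = a` and `B ⊆ N(x)`; for fixed `B`
there are at most `a − 1` stars (else an `a × a` clique), so `Δ ≤ (a−1) C(n,a)` (2.4); for fixed
`x` there are `C(d(x), a)` stars, so `Δ = Σ_x C(d(x),a) ≥ n·C(|E|/n, a)` by Jensen (2.5); comparing,
`n (|E|/n − (a−1))^a ≤ (a−1)(n − (a−1))^a`, whence the bound.

PROVED here (theorems only, no named facts), for a bipartite graph given as a finite set of edges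
`E ⊆ α × β` between finite types (`|α| = m` "rows", `|β| = n` "columns"), in the general
`s × t`-clique-free form (`s` vertices of `α`, `t` of `β`; Jukna's statement is `m = n`,
`s = t = a`):
* `sum_card_powersetCard_neighbors` — double counting of stars:
  `Σ_x C(d(x), t) = Σ_{|B| = t} #{x : B ⊆ N(x)}`;
* **`kovari_sos_turan_choose`** — the counting core (2.4)–(2.5): no `s × t` clique ⇒
  `Σ_x C(d(x), t) ≤ (s − 1) · C(n, t)`;
* **`kovari_sos_turan`** — the bound `|E| ≤ (s−1)^{1/t} · n · m^{1−1/t} + (t−1) m` (Jensen in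
  the power-mean form `(Σ f)^t ≤ m^{t−1} Σ f^t`, with `C(d,t) ≥ (d+1−t)^t/t!`, `C(n,t) ≤ n^t/t!`);
* `kovari_sos_turan_square` — Theorem 2.4 as printed: parts of size `n`, no `a × a` clique ⇒
  `|E| ≤ (a−1)^{1/a} n^{2−1/a} + (a−1) n`.

## References

* [Jukna2001] S. Jukna, *Extremal Combinatorics*, 1st ed., Springer (2001), Theorem 2.4 and its
  proof (held text `book:jukna2011-extremal-combinatorics-with-applications-computer-science`,
  chunk 37).
* [KovariSosTuran1954] T. Kővári, V. T. Sós, P. Turán, Colloq. Math. 3 (1954) 50–57,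
  doi:10.4064/cm-3-1-50-57.
-/

namespace Literature.Combinatorics.Extremal

open Finset

variable {α β : Type*} [Fintype α] [Fintype β] [DecidableEq α] [DecidableEq β]

/-! ### Double counting of stars -/

/-- **Stars counted two ways.** With `N(x) = {y : (x,y) ∈ E}` and `d(x) = |N(x)|`:
`Σ_x C(d(x), t) = Σ_{B ⊆ β, |B| = t} #{x : B ⊆ N(x)}` — both count the stars `S(x, B)`,
`|B| = t`, `B ⊆ N(x)`. [cite: Jukna2001, Ch. 2 §2.2, proof of Theorem 2.4 ("We may count the
stars `S(x,B)` in two ways")] -/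
theorem sum_card_powersetCard_neighbors (E : Finset (α × β)) (t : ℕ) :
    ∑ x : α, ((Finset.univ.filter fun y => (x, y) ∈ E).card).choose t =
      ∑ B ∈ Finset.powersetCard t (Finset.univ : Finset β),
        (Finset.univ.filter fun x : α => B ⊆ Finset.univ.filter fun y => (x, y) ∈ E).card := by
  calc ∑ x : α, ((Finset.univ.filter fun y => (x, y) ∈ E).card).choose t
      = ∑ x : α, ∑ B ∈ Finset.powersetCard t (Finset.univ : Finset β),
          (if B ⊆ Finset.univ.filter (fun y => (x, y) ∈ E) then 1 else 0) := by
        refine Finset.sum_congr rfl fun x _ => ?_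
        rw [Finset.sum_boole, ← Finset.card_powersetCard t (Finset.univ.filter fun y => (x, y) ∈ E)]
        congr 1
        ext B
        simp only [Finset.mem_filter, Finset.mem_powersetCard, Finset.subset_univ, true_and]
        tauto
    _ = ∑ B ∈ Finset.powersetCard t (Finset.univ : Finset β),
          (Finset.univ.filter fun x : α => B ⊆ Finset.univ.filter fun y => (x, y) ∈ E).card := by
        rw [Finset.sum_comm]
        refine Finset.sum_congr rfl fun B _ => ?_
        rw [Finset.sum_boole]
        simp

/-- **The counting core of Theorem 2.4 ((2.4)–(2.5)).** If the bipartite graph `E ⊆ α × β` contains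
no `s × t` clique (`A ×ˢ B ⊆ E` with `|A| = s`, `|B| = t`), then every `t`-set `B` lies in at most
`s − 1` neighbourhoods, so `Σ_x C(d(x), t) ≤ (s − 1) · C(n, t)`, `n = |β|`.
[cite: Jukna2001, Ch. 2 §2.2, Theorem 2.4, proof, (2.4)–(2.5); KovariSosTuran1954] -/
theorem kovari_sos_turan_choose (E : Finset (α × β)) (s t : ℕ) (hs : 1 ≤ s)
    (hfree : ∀ (A : Finset α) (B : Finset β), A.card = s → B.card = t → ¬ A ×ˢ B ⊆ E) :
    ∑ x : α, ((Finset.univ.filter fun y => (x, y) ∈ E).card).choose t ≤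
      (s - 1) * (Fintype.card β).choose t := by
  rw [sum_card_powersetCard_neighbors]
  have hB : ∀ B ∈ Finset.powersetCard t (Finset.univ : Finset β),
      (Finset.univ.filter fun x : α => B ⊆ Finset.univ.filter fun y => (x, y) ∈ E).card ≤ s - 1 := by
    intro B hB
    by_contra hlt
    push Not at hlt
    obtain ⟨A, hA, hAcard⟩ := Finset.exists_subset_card_eq
      (s := Finset.univ.filter fun x : α => B ⊆ Finset.univ.filter fun y => (x, y) ∈ E)
      (n := s) (by omega)
    apply hfree A B hAcard (Finset.mem_powersetCard.mp hB).2
    intro p hp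
    rw [Finset.mem_product] at hp
    have hx := Finset.mem_filter.mp (hA hp.1)
    have hy := Finset.mem_filter.mp (hx.2 hp.2)
    exact hy.2
  refine (Finset.sum_le_sum hB).trans ?_
  rw [Finset.sum_const, Finset.card_powersetCard, Finset.card_univ, smul_eq_mul, mul_comm]

/-! ### The bound -/

/-- **The Kővári–Sós–Turán theorem.** If a bipartite graph with parts of sizes `m = |α|` and
`n = |β|` (edge set `E ⊆ α × β`) contains no `s × t` clique, `s, t ≥ 1`, then
`|E| ≤ (s−1)^{1/t} · n · m^{1−1/t} + (t − 1) · m`. [cite: Jukna2001, Ch. 2 §2.2, Theorem 2.4 and its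
proof; KovariSosTuran1954] -/
theorem kovari_sos_turan (E : Finset (α × β)) (s t : ℕ) (hs : 1 ≤ s) (ht : 1 ≤ t)
    (hfree : ∀ (A : Finset α) (B : Finset β), A.card = s → B.card = t → ¬ A ×ˢ B ⊆ E) :
    (E.card : ℝ) ≤ ((s : ℝ) - 1) ^ (1 / (t : ℝ)) * Fintype.card β *
        (Fintype.card α : ℝ) ^ (1 - 1 / (t : ℝ)) + ((t : ℝ) - 1) * Fintype.card α := by
  classical
  set m := Fintype.card α with hm
  set n := Fintype.card β with hn
  set d : α → ℕ := fun x => (Finset.univ.filter fun y => (x, y) ∈ E).card with hd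
  -- `|E| = Σ_x d(x)`
  have hEsum : E.card = ∑ x, d x := by
    rw [Finset.card_eq_sum_card_fiberwise (f := Prod.fst) (t := Finset.univ)
      (fun p _ => Finset.mem_univ _)]
    refine Finset.sum_congr rfl fun x _ => ?_
    refine Finset.card_bij (fun p _ => p.2) ?_ ?_ ?_
    · intro p hp
      rw [Finset.mem_filter] at hp ⊢
      exact ⟨Finset.mem_univ _, by rw [← hp.2]; exact hp.1⟩
    · intro p hp q hq h
      rw [Finset.mem_filter] at hp hq
      exact Prod.ext (hp.2.trans hq.2.symm) h
    · intro y hy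
      exact ⟨(x, y), Finset.mem_filter.mpr ⟨(Finset.mem_filter.mp hy).2, rfl⟩, rfl⟩
  -- the counting core, in `ℝ`
  have hcount : (∑ x, ((d x).choose t : ℝ)) ≤ ((s : ℝ) - 1) * (n.choose t : ℝ) := by
    have h := kovari_sos_turan_choose E s t hs hfree
    have h' : ((∑ x, (d x).choose t : ℕ) : ℝ) ≤ (((s - 1) * n.choose t : ℕ) : ℝ) := by
      exact_mod_cast h
    push_cast [Nat.cast_sub hs] at h'
    exact h'
  -- `C(d,t) ≥ (d+1−t)^t / t!` and `C(n,t) ≤ n^t / t!`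
  set f : α → ℝ := fun x => ((d x + 1 - t : ℕ) : ℝ) with hf
  have hf0 : ∀ x, 0 ≤ f x := fun x => Nat.cast_nonneg _
  have hfact : (0 : ℝ) < (t.factorial : ℝ) := by exact_mod_cast Nat.factorial_pos t
  have hsumpow : ∑ x, f x ^ t ≤ ((s : ℝ) - 1) * (n : ℝ) ^ t := by
    have h1 : ∀ x, f x ^ t / t.factorial ≤ ((d x).choose t : ℝ) := fun x => by
      have := Nat.pow_le_choose (α := ℝ) t (d x)
      simpa [hf] using this
    have h2 : (n.choose t : ℝ) ≤ (n : ℝ) ^ t / t.factorial := by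
      have := Nat.choose_le_pow_div (α := ℝ) t n
      simpa using this
    have h3 : (∑ x, f x ^ t) / t.factorial ≤ ((s : ℝ) - 1) * ((n : ℝ) ^ t / t.factorial) := by
      rw [Finset.sum_div]
      refine (Finset.sum_le_sum fun x _ => h1 x).trans (hcount.trans ?_)
      have hs1 : (0 : ℝ) ≤ (s : ℝ) - 1 := by
        have : (1 : ℝ) ≤ s := by exact_mod_cast hs
        linarith
      exact mul_le_mul_of_nonneg_left h2 hs1
    rw [← mul_div_assoc, div_le_div_iff_of_pos_right hfact] at h3
    exact h3
  -- `Σ_x f(x) ≥ |E| − (t−1) m`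
  have hsumf : (E.card : ℝ) - ((t : ℝ) - 1) * m ≤ ∑ x, f x := by
    have h1 : ∀ x, (d x : ℝ) - ((t : ℝ) - 1) ≤ f x := by
      intro x
      simp only [hf]
      have : (d x : ℝ) + 1 - t ≤ ((d x + 1 - t : ℕ) : ℝ) := by
        by_cases h : t ≤ d x + 1
        · rw [Nat.cast_sub h]; push_cast; exact le_rfl
        · push Not at h
          rw [Nat.sub_eq_zero_of_le h.le]
          have : ((d x + 1 : ℕ) : ℝ) < t := by exact_mod_cast h
          push_cast at this
          simp only [Nat.cast_zero]
          linarith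
      linarith
    calc (E.card : ℝ) - ((t : ℝ) - 1) * m = ∑ x : α, ((d x : ℝ) - ((t : ℝ) - 1)) := by
          rw [Finset.sum_sub_distrib, Finset.sum_const, Finset.card_univ, ← hm, nsmul_eq_mul, hEsum]
          push_cast
          ring
      _ ≤ ∑ x, f x := Finset.sum_le_sum fun x _ => h1 x
  -- Jensen (power mean): `(Σ f)^t ≤ m^{t−1} Σ f^t`
  obtain ⟨t', rfl⟩ : ∃ t', t = t' + 1 := ⟨t - 1, by omega⟩
  have hjensen : (∑ x, f x) ^ (t' + 1) ≤ (m : ℝ) ^ t' * ∑ x, f x ^ (t' + 1) := by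
    have := pow_sum_le_card_mul_sum_pow (s := Finset.univ) (f := f) (fun x _ => hf0 x) t'
    rwa [Finset.card_univ, ← hm] at this
  -- conclude
  set L := (E.card : ℝ) - (((t' + 1 : ℕ) : ℝ) - 1) * m with hL
  by_cases hLpos : L ≤ 0
  · -- trivial case `|E| ≤ (t−1) m`
    have h0 : (0 : ℝ) ≤ (((s : ℝ) - 1) ^ (1 / ((t' + 1 : ℕ) : ℝ))) * n *
        (m : ℝ) ^ (1 - 1 / ((t' + 1 : ℕ) : ℝ)) := by
      have hs1 : (0 : ℝ) ≤ (s : ℝ) - 1 := by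
        have : (1 : ℝ) ≤ s := by exact_mod_cast hs
        linarith
      positivity
    linarith
  · push Not at hLpos
    -- `L^t ≤ (Σ f)^t ≤ m^{t−1} (s−1) n^t`
    have hLt : L ^ (t' + 1) ≤ (m : ℝ) ^ t' * (((s : ℝ) - 1) * (n : ℝ) ^ (t' + 1)) :=
      (pow_le_pow_left₀ hLpos.le hsumf (t' + 1)).trans
        (hjensen.trans (mul_le_mul_of_nonneg_left hsumpow (by positivity)))
    -- take `t`-th roots
    have hs1 : (0 : ℝ) ≤ (s : ℝ) - 1 := by
      have : (1 : ℝ) ≤ s := by exact_mod_cast hs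
      linarith
    have htpos : (0 : ℝ) < ((t' + 1 : ℕ) : ℝ) := by positivity
    have hroot := Real.rpow_le_rpow (pow_nonneg hLpos.le _) hLt
      (le_of_lt (one_div_pos.mpr htpos))
    rw [← Real.rpow_natCast L (t' + 1), ← Real.rpow_mul hLpos.le,
      mul_one_div_cancel htpos.ne', Real.rpow_one] at hroot
    -- simplify the right-hand side
    have hrhs : ((m : ℝ) ^ t' * (((s : ℝ) - 1) * (n : ℝ) ^ (t' + 1))) ^ (1 / ((t' + 1 : ℕ) : ℝ)) =
        ((s : ℝ) - 1) ^ (1 / ((t' + 1 : ℕ) : ℝ)) * n * (m : ℝ) ^ (1 - 1 / ((t' + 1 : ℕ) : ℝ)) := by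
      have hm0 : (0 : ℝ) ≤ m := Nat.cast_nonneg _
      have hn0 : (0 : ℝ) ≤ n := Nat.cast_nonneg _
      rw [Real.mul_rpow (by positivity) (by positivity), Real.mul_rpow hs1 (by positivity)]
      -- `(n^t)^{1/t} = n`, `(m^{t−1})^{1/t} = m^{1−1/t}`
      have h1 : ((n : ℝ) ^ (t' + 1)) ^ (1 / ((t' + 1 : ℕ) : ℝ)) = n := by
        rw [one_div, Real.pow_rpow_inv_natCast hn0 (Nat.succ_ne_zero t')]
      have h2 : ((m : ℝ) ^ t') ^ (1 / ((t' + 1 : ℕ) : ℝ)) =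
          (m : ℝ) ^ (1 - 1 / ((t' + 1 : ℕ) : ℝ)) := by
        rw [← Real.rpow_natCast (m : ℝ) t', ← Real.rpow_mul hm0]
        congr 1
        field_simp
        push_cast
        ring
      rw [h1, h2]
      ring
    rw [hrhs] at hroot
    rw [hL] at hroot
    linarith

/-- **Theorem 2.4 as printed (Kővári–Sós–Turán 1954): `k_a(n) ≤ (a−1)^{1/a} n^{2−1/a} + (a−1)n`.**
A bipartite graph with both parts of size `n` and no `a × a` clique (`a ≥ 1`) has at most
`(a−1)^{1/a} n^{2−1/a} + (a−1) n` edges. [cite: Jukna2001, Ch. 2 §2.2, Theorem 2.4;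
KovariSosTuran1954] -/
theorem kovari_sos_turan_square (E : Finset (α × β)) (a : ℕ) (ha : 1 ≤ a) {n : ℕ}
    (hα : Fintype.card α = n) (hβ : Fintype.card β = n)
    (hfree : ∀ (A : Finset α) (B : Finset β), A.card = a → B.card = a → ¬ A ×ˢ B ⊆ E) :
    (E.card : ℝ) ≤ ((a : ℝ) - 1) ^ (1 / (a : ℝ)) * (n : ℝ) ^ (2 - 1 / (a : ℝ)) + ((a : ℝ) - 1) * n := by
  have h := kovari_sos_turan E a a ha ha hfree
  rw [hα, hβ] at h
  have hn : (0 : ℝ) ≤ n := Nat.cast_nonneg _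
  have hpow : (n : ℝ) * (n : ℝ) ^ (1 - 1 / (a : ℝ)) = (n : ℝ) ^ (2 - 1 / (a : ℝ)) := by
    rw [show (2 : ℝ) - 1 / a = 1 + (1 - 1 / a) by ring]
    rcases hn.eq_or_lt with h0 | hpos
    · rw [← h0]
      have : (1 : ℝ) + (1 - 1 / a) ≠ 0 := by
        have ha' : (1 : ℝ) ≤ a := by exact_mod_cast ha
        have : (1 : ℝ) / a ≤ 1 := by rw [div_le_one (by linarith)]; exact ha'
        linarith
      rw [Real.zero_rpow this, zero_mul]
    · rw [Real.rpow_add hpos, Real.rpow_one]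
  calc (E.card : ℝ) ≤ ((a : ℝ) - 1) ^ (1 / (a : ℝ)) * n * (n : ℝ) ^ (1 - 1 / (a : ℝ)) +
        ((a : ℝ) - 1) * n := h
    _ = ((a : ℝ) - 1) ^ (1 / (a : ℝ)) * (n : ℝ) ^ (2 - 1 / (a : ℝ)) + ((a : ℝ) - 1) * n := by
        rw [mul_assoc, hpow]

end Literature.Combinatorics.Extremal
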